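/-
Copyright: h21 programme. Stub-ideation companion (k = 1, GENERATION 12, HOME FAMILY 1 — RECOGNISE & IMPORT)
— NOT a route file, NOT a Theorems file.  Purpose: CLOSE THE LAST THREE OPEN LEAVES of the k2 road for
`stub_switch` — Piece A (`SquareSource`: A1 `negOneIsSquare : NegOneIsSquare`, A2 `helper_exists_tau_sq_eq_neg`,
k2 statements verbatim) SORRY-FREE (§1–§6), and B6α `helper_fixed_cusp_root` modulo the gen-6 kernel
certificate (§7, composition with the certificate kernel-checked in scratch).  0 `sorry` in this file.
Imports no other crux workfile (the farm does not build them as modules); the k2-g7 entry-level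
vocabulary / transport it needs is COPIED (credit: ideator k2), the heavy gen-7 tables `normC3_gen`,
`normU_gen` (40 M heartbeats each) are REPLACED by cheap parametrised ones (`cen3_det2/4`, `fix_pow`).
-/
import Literature.NumberTheory.Automorphic.CDTTheorem712
import Literature.NumberTheory.GaloisRepresentations.ModNCyclotomicCharacter
import Literature.NumberTheory.GaloisRepresentations.ImaginaryQuadraticCyclotomicProofs
import Literature.NumberTheory.EllipticCurves.ModFiveCongruenceHessePolynomials
import Literature.NumberTheory.EllipticCurves.TorsionCardinality
import HarnessLib

/-!
# Stub-ideation k = 1, GENERATION 12 (RECOGNISE & IMPORT) for `stub_switch` of crux `FreyModularity`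

Companion to `STUB-IDEAS-stub_switch-1.md` (gen 12).

WHAT IS NEW (gen 12).
* **A1 is a THEOREM, in a STRONGER, `H`-free and non-abelian-free form** `exists_sq_eq_neg_one`:
  `G ≤ GL₂(𝔽₅)` with `det G = 𝔽₅ˣ` and NO common `𝔽₅`-eigenline ⇒ some `g ∈ G` has `g² = −1`.
  (The recognised fact: a subgroup of `GL₂(𝔽₅)` acting irreducibly on `𝔽₅²` either meets
  `SL₂(𝔽₅) ∖ {±1}` — then the gen-7 order-spectrum split on one element `g₀` runs with `H := G` —
  or is `{±g₂ᵏ}` for an element `g₂` of determinant `2` without rational eigenline, and then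
  `g₂ ∈ C_ns`, `(g₂⁶)² = N(g₂)² = 4 = −1`.)  k2's `NegOneIsSquare` (verbatim) is a one-line corollary.
  Every finite fact is kernel-`decide`d at entry level (§2, each ≤ 4 M heartbeats; the two 40 M gen-7
  tables are not needed: the normaliser of `⟨s⟩` is handled by the ALGEBRAIC centraliser lemma
  `comm_lin` + 500-case tables `cen3_det2`, `cen3_det4`, the normaliser of `⟨u⟩` by the 600-case `fix_pow`).
* **A2 is a THEOREM** (`helper_exists_tau_sq_eq_neg`, k2-g9 signature verbatim): `G := ρ̄(Γ_ℚ)`;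
  `det ρ̄ = χ̄₅` (tree THEOREM `det_eq_modPCyclotomicCharacter_of_isTorsionGaloisRep_holds`) and `χ̄₅` onto
  (tree THEOREM `Rat.modNCyclotomicCharacter_surjective`) give `det G = 𝔽₅ˣ`; absolute irreducibility over
  `ℚ(√5)` gives irreducibility over `𝔽₅` (`IsAbsIrreducibleOverSqrt.isAbsolutelyIrreducible`, `.isIrreducible`),
  i.e. no `G`-stable line `𝔽₅·w` (a `Subrepresentation` on `span {w}`); A1 gives `ρ̄(τ)² = −1`, the frame of
  `IsTorsionGaloisRep` turns it into `τ • (τ • P) = −P`, and `χ̄₅(τ²) = det(ρ̄ τ)² = det(−1) = 1`.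
  NO `ℚ(√5)`-restriction / `det(H)² = 1` / non-abelian step is needed any more.
* hence **`squareSource : SquareSource` (k2-g9 Piece A, verbatim) is PROVED** (§6).
* **B6α** (§7): `helper_fixed_cusp_root_of_cert (hcert : CuspCertificate) <k2-g9 binders verbatim>` is a THEOREM —
  non-zero `T = (x,y) ∈ B[5]` from `exists_isTorsionGaloisRep 5`; `φT = −T` read coordinatewise
  (`Affine.Point.map_some/neg_some`) gives `φx = x`; `5•T = 0` gives `ψ₅(x) = 0` (`zsmul_some_eq_zero_iff_eval_ΨSq`,
  `ΨSq_ofNat`, gen-6 bridge `eval_preΨ'_five`); `y ≠ 0` since `T` has odd order; `χ̄₅(φ) = 1` fixes a primitive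
  `ζ₅` (`modNCyclotomicCharacter_spec`), so `p = ζ + ζ⁴` (`p² + p = 1`, `IsPrimitiveRoot.geom_sum_eq_zero`) is
  `φ`-fixed; the CERTIFICATE gives `𝔇(LL, MM) = 0`, `MM = 12y² ≠ 0`, homogeneity `D_smul` gives the root
  `ξ = LL/MM` of `𝔇(·,1)`, fixed by `φ` (`map_div₀`, `map_intCast`).  `CuspCertificate` = the statement of
  `StubSwitchK2G6.D_LL_MM_eq_zero` over `\bar ℚ` (PROVED there).
AFTER THIS FILE the k2 road (`stubSwitch_of_helpers`, k2-g9) has NO open helper left except the named fact F1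
`HesseFamilyFive.thm132_geomTorsionFive_of_hesseFamily` (hypothesis `hF`): A1/A2/B6α here, Piece C + B2 + B3 in
k1-g10, I0/B5/B6β/B6γ/B7/B8a/B8b/B8d/B9 in k1-g11, B4 + every join in k2-g9, the syzygy (k2-g5) and the cusp
certificate (k2-g6) PROVED by k2.
Disproof honoured: `Disproof.switch_false_without_det` — `det ρ̄ = χ̄₅` onto is used in BOTH branches of A1
(`g₂` with `det g₂ = 2`) and in A2.
-/

set_option linter.style.longLine false
set_option linter.dupNamespace false
set_option linter.unusedVariables false

namespace Summit.ABC.ABC.Cruxes.FreyModularity.StubSwitchK1G12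

open scoped Matrix

/-! ## §1 entry-level vocabulary (VERBATIM from k2 gen 6/7, ns `…StubSwitchK2G7`; plus `lin`) -/

/-- entry-level `2×2` matrices over `𝔽₅`. -/
abbrev M2 := Fin 2 → Fin 2 → ZMod 5
/-- explicit product (`= A * B`, `toM2_mul`). -/
def mul2 (A B : M2) : M2 := fun i j => A i 0 * B 0 j + A i 1 * B 1 j
/-- explicit determinant (`= det`, `d_toM2`). -/
def d (A : M2) : ZMod 5 := A 0 0 * A 1 1 - A 0 1 * A 1 0
def one2 : M2 := fun i j => if i = j then 1 else 0
def neg2 : M2 := fun i j => if i = j then -1 else 0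
def sq2 (A : M2) : M2 := mul2 A A
def p3 (A : M2) : M2 := mul2 (sq2 A) A
def p4 (A : M2) : M2 := sq2 (sq2 A)
def p6 (A : M2) : M2 := mul2 (mul2 (sq2 A) (sq2 A)) (sq2 A)
def app (A : M2) (v : Fin 2 → ZMod 5) : Fin 2 → ZMod 5 := fun i => A i 0 * v 0 + A i 1 * v 1
/-- explicit matrix `[[a,b],[c,e]]`. -/
def m (a b c e : ZMod 5) : M2 := fun i j => if i = 0 then (if j = 0 then a else b) else (if j = 0 then c else e)
/-- `a·1 + b·S` (the generic element of the centraliser algebra `𝔽₅[S]`). -/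
def lin (a b : ZMod 5) (S : M2) : M2 := fun i j => a * one2 i j + b * S i j

/-- the 24 elements of order `5` of `SL₂(𝔽₅)` (complete: `mem_u5List`). -/
def u5List : List M2 :=
  [m 0 1 4 2, m 0 2 2 2, m 0 3 3 2, m 0 4 1 2, m 1 0 1 1, m 1 0 2 1, m 1 0 3 1, m 1 0 4 1,
   m 1 1 0 1, m 1 2 0 1, m 1 3 0 1, m 1 4 0 1, m 2 1 4 0, m 2 2 2 0, m 2 3 3 0, m 2 4 1 0,
   m 3 1 1 4, m 3 2 3 4, m 3 3 2 4, m 3 4 4 4, m 4 1 1 3, m 4 2 3 3, m 4 3 2 3, m 4 4 4 3]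

/-- the 20 elements of order `3` of `SL₂(𝔽₅)` (complete: `mem_s3List`). -/
def s3List : List M2 :=
  [m 0 1 4 4, m 0 2 2 4, m 0 3 3 4, m 0 4 1 4, m 1 1 2 3, m 1 2 1 3, m 1 3 4 3, m 1 4 3 3,
   m 2 1 3 2, m 2 2 4 2, m 2 3 1 2, m 2 4 2 2, m 3 1 2 1, m 3 2 1 1, m 3 3 4 1, m 3 4 3 1,
   m 4 1 4 0, m 4 2 2 0, m 4 3 3 0, m 4 4 1 0]

/-- a vector spanning the fixed line of a unipotent `u ≠ 1` (`fixv_spec`). -/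
def fixv (U : M2) : Fin 2 → ZMod 5 :=
  if (fun i => U i 0 - one2 i 0) ≠ (fun _ => (0 : ZMod 5)) then (fun i => U i 0 - one2 i 0)
  else (fun i => U i 1 - one2 i 1)

/-! ## §2 the kernel-decided facts (all CHEAP: ≤ 625·k cases each) -/

set_option maxHeartbeats 4000000 in
set_option maxRecDepth 100000 in
/-- **order split of `SL₂(𝔽₅)` in one table**: `A = ±1`, or `A² = −1`, or `A²` has order `3`, or `A²` has
order `5` (orders `{1,2,3,4,5,6,10}`). Replaces gen-7 `orders_SL2` + `invol`. -/
theorem order_cases : ∀ A : M2, d A = 1 → A ≠ one2 → A ≠ neg2 →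
    (sq2 A = neg2 ∨ sq2 A ∈ s3List ∨ sq2 A ∈ u5List) := by
  decide

set_option maxHeartbeats 4000000 in
set_option maxRecDepth 100000 in
/-- completeness of `u5List` (gen 7, verbatim). -/
theorem mem_u5List : ∀ A : M2, (d A = 1 ∧ mul2 (p4 A) A = one2 ∧ A ≠ one2) → A ∈ u5List := by
  decide

set_option maxHeartbeats 4000000 in
set_option maxRecDepth 100000 in
/-- completeness of `s3List` (gen 7, verbatim). -/
theorem mem_s3List : ∀ A : M2, (d A = 1 ∧ p3 A = one2 ∧ A ≠ one2) → A ∈ s3List := by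
  decide

set_option maxHeartbeats 4000000 in
set_option maxRecDepth 100000 in
theorem u5List_sound : ∀ A ∈ u5List, d A = 1 ∧ mul2 (p4 A) A = one2 ∧ A ≠ one2 := by
  decide

set_option maxHeartbeats 4000000 in
set_option maxRecDepth 100000 in
theorem s3List_sound : ∀ A ∈ s3List, d A = 1 ∧ p3 A = one2 ∧ A ≠ one2 ∧ A 0 1 ≠ 0 := by
  decide

set_option maxHeartbeats 4000000 in
set_option maxRecDepth 100000 in
/-- pair lemma, order 5 (gen 7, verbatim). -/
theorem u5_pair : ∀ A ∈ u5List, ∀ B ∈ u5List, mul2 A B ≠ mul2 B A →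
    (sq2 (mul2 A B) = neg2 ∨ sq2 (mul2 (sq2 A) B) = neg2 ∨ sq2 (mul2 (p3 A) B) = neg2 ∨
      sq2 (mul2 (p4 A) B) = neg2) := by
  decide

set_option maxHeartbeats 4000000 in
set_option maxRecDepth 100000 in
/-- commuting elements of order 5 generate the same `C₅` (gen 7, verbatim). -/
theorem u5_comm : ∀ A ∈ u5List, ∀ B ∈ u5List, mul2 A B = mul2 B A →
    (B = A ∨ B = sq2 A ∨ B = p3 A ∨ B = p4 A) := by
  decide

set_option maxHeartbeats 4000000 in
set_option maxRecDepth 100000 in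
/-- pair lemma, order 3 (gen 7, verbatim). -/
theorem s3_pair : ∀ A ∈ s3List, ∀ B ∈ s3List, mul2 A B ≠ mul2 B A →
    (sq2 (mul2 A B) = neg2 ∨ sq2 (mul2 (sq2 A) B) = neg2 ∨
      sq2 (mul2 (mul2 (mul2 (sq2 A) B) A) B) = neg2) := by
  decide

set_option maxHeartbeats 4000000 in
set_option maxRecDepth 100000 in
/-- commuting elements of order 3 generate the same `C₃` (gen 7, verbatim). -/
theorem s3_comm : ∀ A ∈ s3List, ∀ B ∈ s3List, mul2 A B = mul2 B A → (B = A ∨ B = sq2 A) := by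
  decide

set_option maxHeartbeats 4000000 in
set_option maxRecDepth 100000 in
/-- **NEW (500 cases): an element of norm `2` of the field `𝔽₅[s] ≅ 𝔽₂₅` has `x⁶ = N(x) = 2`, so `(x⁶)² = −1`.** -/
theorem cen3_det2 : ∀ S ∈ s3List, ∀ a b : ZMod 5, d (lin a b S) = 2 → sq2 (p6 (lin a b S)) = neg2 := by
  decide

set_option maxHeartbeats 4000000 in
set_option maxRecDepth 100000 in
/-- **NEW (500 cases): an element of norm `4 = −1` of `𝔽₅[s]` has `x⁶ = −1`.** -/
theorem cen3_det4 : ∀ S ∈ s3List, ∀ a b : ZMod 5, d (lin a b S) = 4 → p6 (lin a b S) = neg2 := by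
  decide

set_option maxHeartbeats 4000000 in
set_option maxRecDepth 100000 in
/-- `fixv u` is a nonzero fixed vector of `u` (gen 7, verbatim). -/
theorem fixv_spec : ∀ U ∈ u5List, fixv U ≠ (fun _ => 0) ∧ app U (fixv U) = fixv U := by
  decide

set_option maxHeartbeats 4000000 in
set_option maxRecDepth 100000 in
/-- **NEW (600 cases, replaces gen-7 `normU_gen`): a vector fixed by a non-trivial power of `u` lies on the
fixed line of `u`.** -/
theorem fix_pow : ∀ U ∈ u5List, ∀ v : Fin 2 → ZMod 5,
    (app U v = v ∨ app (sq2 U) v = v ∨ app (p3 U) v = v ∨ app (p4 U) v = v) →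
    v 0 * fixv U 1 = v 1 * fixv U 0 := by
  decide

set_option maxHeartbeats 4000000 in
set_option maxRecDepth 100000 in
/-- collinear with a nonzero vector ⇒ a multiple of it (gen 7, verbatim). -/
theorem collinear : ∀ w z : Fin 2 → ZMod 5, w ≠ (fun _ => 0) → z 0 * w 1 = z 1 * w 0 →
    ∃ c : ZMod 5, z = fun i => c * w i := by
  decide

set_option maxHeartbeats 4000000 in
set_option maxRecDepth 100000 in
/-- **NEW (625 cases): an element of determinant `2` either has a rational eigenline or lies in a non-split
Cartan, where `(g⁶)² = N(g)² = −1`.** -/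
theorem eig_or_p6 : ∀ B : M2, d B = 2 →
    (∃ w : Fin 2 → ZMod 5, w ≠ (fun _ => 0) ∧ ∃ c : ZMod 5, app B w = fun i => c * w i) ∨
      sq2 (p6 B) = neg2 := by
  decide

/-- the non-zero elements of `𝔽₅` are the powers `2ᵏ`, `k ≤ 3`. -/
theorem zmod5_cases : ∀ x : ZMod 5, x ≠ 0 → (x = 2 ^ 0 ∨ x = 2 ^ 1 ∨ x = 2 ^ 2 ∨ x = 2 ^ 3) := by
  decide

/-- `q⁻¹ = q³` in `𝔽₅ˣ`. -/
theorem zmod5_mul_cube : ∀ q : ZMod 5, q ≠ 0 → q * q ^ 3 = 1 := by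
  decide

/-! ## §3 transport `GL (Fin 2) (ZMod 5)` → entries (gen 7 verbatim + `app_mul2`, `app_eq_smul`) -/

/-- the entries of `g ∈ GL₂(𝔽₅)`. -/
def toM2 (g : GL (Fin 2) (ZMod 5)) : M2 := fun i j => (g : Matrix (Fin 2) (Fin 2) (ZMod 5)) i j

theorem toM2_mul (g h : GL (Fin 2) (ZMod 5)) : toM2 (g * h) = mul2 (toM2 g) (toM2 h) := by
  ext i j
  simp [toM2, mul2, Matrix.mul_apply, Fin.sum_univ_two]

theorem toM2_one : toM2 (1 : GL (Fin 2) (ZMod 5)) = one2 := by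
  ext i j
  simp [toM2, one2, Matrix.one_apply]

theorem toM2_neg_one : toM2 (-1 : GL (Fin 2) (ZMod 5)) = neg2 := by
  ext i j
  by_cases h : i = j <;> simp [toM2, neg2, h]

theorem d_toM2 (g : GL (Fin 2) (ZMod 5)) : d (toM2 g) = (Matrix.GeneralLinearGroup.det g : ZMod 5) := by
  simp [d, toM2, Matrix.GeneralLinearGroup.val_det_apply, Matrix.det_fin_two]

theorem toM2_injective : Function.Injective toM2 := by
  intro g h hgh
  apply Units.ext
  ext i j
  exact congrFun (congrFun hgh i) j

theorem mulVec_eq_app (g : GL (Fin 2) (ZMod 5)) (w : Fin 2 → ZMod 5) :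
    (g : Matrix (Fin 2) (Fin 2) (ZMod 5)).mulVec w = app (toM2 g) w := by
  ext i
  simp [toM2, app, Matrix.mulVec, dotProduct, Fin.sum_univ_two]

theorem app_mul2 (A B : M2) (v : Fin 2 → ZMod 5) : app (mul2 A B) v = app A (app B v) := by
  ext i
  simp only [app, mul2]
  ring

theorem app_eq_smul (c : ZMod 5) (w : Fin 2 → ZMod 5) : (fun i => c * w i) = c • w := by
  ext i
  simp

/-- `g² = −1` read back from the entries. -/
theorem sq_eq_neg_one_of_toM2 {g : GL (Fin 2) (ZMod 5)} (h : sq2 (toM2 g) = neg2) : g * g = -1 :=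
  toM2_injective (by rw [toM2_mul, toM2_neg_one]; exact h)

/-- `g¹² = −1` read back from `sq2 (p6 (toM2 g)) = neg2`, as a square. -/
theorem pow12_of_toM2 {g : GL (Fin 2) (ZMod 5)} (h : sq2 (p6 (toM2 g)) = neg2) :
    (((g * g) * (g * g)) * (g * g)) * (((g * g) * (g * g)) * (g * g)) = -1 :=
  toM2_injective (by simp only [toM2_mul, toM2_neg_one]; exact h)

/-! ## §4 the ALGEBRAIC centraliser lemma (replaces the 12 500-case filters of gen-7 `normC3_gen`) -/

/-- **`B` commutes with `S`, `S₀₁ ≠ 0` ⇒ `B = a·1 + b·S`** (entrywise, over the ring `𝔽₅`; `q⁻¹ = q³`). -/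
theorem comm_lin (S B : M2) (hq : S 0 1 ≠ 0) (h : mul2 B S = mul2 S B) :
    ∃ a b : ZMod 5, B = lin a b S := by
  have hq' := zmod5_mul_cube (S 0 1) hq
  have e1 := congrFun (congrFun h 0) 0
  have e2 := congrFun (congrFun h 0) 1
  simp only [mul2] at e1 e2
  refine ⟨B 0 0 - B 0 1 * S 0 1 ^ 3 * S 0 0, B 0 1 * S 0 1 ^ 3, ?_⟩
  funext i j
  fin_cases i <;> fin_cases j
  · simp [lin, one2]
  · simp only [lin, one2, Fin.zero_eta, Fin.mk_one, zero_ne_one, if_false, mul_zero, zero_add]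
    linear_combination (-(B 0 1)) * hq'
  · simp only [lin, one2, Fin.zero_eta, Fin.mk_one, one_ne_zero, if_false, mul_zero, zero_add]
    linear_combination (-(B 1 0)) * hq' - S 0 1 ^ 3 * e1
  · simp only [lin, one2, Fin.mk_one, if_true, mul_one]
    linear_combination (B 0 0 - B 1 1) * hq' - S 0 1 ^ 3 * e2

/-! ## §5 A1 — the group-theoretic core, `H`-free and non-abelian-free (THEOREM) -/

section Core

variable (G : Subgroup (GL (Fin 2) (ZMod 5)))

/-- closure of "`w` is an eigenvector" under products. -/
theorem mulVec_line_mul {g g' : GL (Fin 2) (ZMod 5)} {w : Fin 2 → ZMod 5} {a b : ZMod 5}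
    (ha : (g : Matrix (Fin 2) (Fin 2) (ZMod 5)) *ᵥ w = a • w)
    (hb : (g' : Matrix (Fin 2) (Fin 2) (ZMod 5)) *ᵥ w = b • w) :
    ((g * g' : GL (Fin 2) (ZMod 5)) : Matrix (Fin 2) (Fin 2) (ZMod 5)) *ᵥ w = (a * b) • w := by
  rw [Units.val_mul, ← Matrix.mulVec_mulVec, hb, Matrix.mulVec_smul, ha, smul_smul, mul_comm]

theorem mulVec_line_pow {g : GL (Fin 2) (ZMod 5)} {w : Fin 2 → ZMod 5} {c : ZMod 5}
    (hc : (g : Matrix (Fin 2) (Fin 2) (ZMod 5)) *ᵥ w = c • w) :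
    ∀ k : ℕ, ((g ^ k : GL (Fin 2) (ZMod 5)) : Matrix (Fin 2) (Fin 2) (ZMod 5)) *ᵥ w = (c ^ k) • w
  | 0 => by simp
  | k + 1 => by rw [pow_succ, pow_succ, mulVec_line_mul (mulVec_line_pow hc k) hc]

/-- **order-3 branch**: `s ∈ G` of order 3 (`det 1`), `g₂ ∈ G` with `det g₂ = 2` ⇒ some `g ∈ G` has `g² = −1`. -/
theorem branch3 {s g₂ : GL (Fin 2) (ZMod 5)} (hs : s ∈ G) (hg₂ : g₂ ∈ G)
    (hS : toM2 s ∈ s3List) (hB : d (toM2 g₂) = 2) : ∃ g ∈ G, g * g = -1 := by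
  obtain ⟨hdS, hS3, hS1, hq⟩ := s3List_sound _ hS
  have hdet_s : Matrix.GeneralLinearGroup.det s = 1 := Units.ext (by rw [← d_toM2]; simpa using hdS)
  have hs3 : s * s * s = 1 := toM2_injective (by rw [toM2_mul, toM2_mul, toM2_one]; exact hS3)
  -- the conjugate `s' = g₂ s g₂⁻¹ ∈ G` is again of order 3
  set s' := g₂ * s * g₂⁻¹ with hs'_def
  have hs'G : s' ∈ G := G.mul_mem (G.mul_mem hg₂ hs) (G.inv_mem hg₂)
  have hS' : toM2 s' ∈ s3List := by
    refine mem_s3List _ ⟨?_, ?_, ?_⟩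
    · rw [d_toM2, hs'_def, map_mul, map_mul, map_inv, hdet_s, mul_one, mul_inv_cancel, Units.val_one]
    · have h3 : s' * s' * s' = 1 := by
        have e : s' * s' * s' = g₂ * (s * s * s) * g₂⁻¹ := by rw [hs'_def]; group
        rw [e, hs3, mul_one, mul_inv_cancel]
      have := congrArg toM2 h3
      rw [toM2_mul, toM2_mul, toM2_one] at this
      exact this
    · intro h1
      apply hS1
      have h1' : s' = 1 := toM2_injective (by rw [h1, toM2_one])
      rw [hs'_def, mul_inv_eq_one, mul_eq_left] at h1'
      rw [h1', toM2_one]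
  by_cases hc : mul2 (toM2 s) (toM2 s') = mul2 (toM2 s') (toM2 s)
  · -- commuting conjugate: `s' = s` or `s' = s²`
    rcases s3_comm _ hS _ hS' hc with h | h
    · -- `g₂` centralises `s`: `g₂ ∈ 𝔽₅[s]`, `(g₂⁶)² = −1`
      have hgs : g₂ * s = s * g₂ := by
        have : s' = s := toM2_injective h
        rwa [hs'_def, mul_inv_eq_iff_eq_mul] at this
      have hcomm : mul2 (toM2 g₂) (toM2 s) = mul2 (toM2 s) (toM2 g₂) := by
        rw [← toM2_mul, ← toM2_mul, hgs]
      obtain ⟨a, b, hab⟩ := comm_lin _ _ hq hcomm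
      have h6 := cen3_det2 _ hS a b (by rw [← hab]; exact hB)
      rw [← hab] at h6
      exact ⟨_, G.mul_mem (G.mul_mem (G.mul_mem hg₂ hg₂) (G.mul_mem hg₂ hg₂)) (G.mul_mem hg₂ hg₂),
        pow12_of_toM2 h6⟩
    · -- `g₂ s g₂⁻¹ = s²`: then `g₂²` centralises `s`, `det g₂² = 4`, `(g₂²)⁶ = −1`
      have hconj : g₂ * s * g₂⁻¹ = s * s := by
        rw [← hs'_def]; exact toM2_injective (h.trans (toM2_mul s s).symm)
      have hgs : (g₂ * g₂) * s = s * (g₂ * g₂) := by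
        have e1 : (g₂ * g₂) * s * (g₂ * g₂)⁻¹ = g₂ * (g₂ * s * g₂⁻¹) * g₂⁻¹ := by group
        have e2 : g₂ * (s * s) * g₂⁻¹ = (g₂ * s * g₂⁻¹) * (g₂ * s * g₂⁻¹) := by group
        have e3 : (s * s) * (s * s) = (s * s * s) * s := by group
        rw [hconj, e2, hconj, e3, hs3, one_mul, mul_inv_eq_iff_eq_mul] at e1
        exact e1
      have hcomm : mul2 (toM2 (g₂ * g₂)) (toM2 s) = mul2 (toM2 s) (toM2 (g₂ * g₂)) := by
        rw [← toM2_mul, ← toM2_mul, hgs]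
      obtain ⟨a, b, hab⟩ := comm_lin _ _ hq hcomm
      have hd4 : d (toM2 (g₂ * g₂)) = 4 := by
        have h2 : (Matrix.GeneralLinearGroup.det g₂ : ZMod 5) = 2 := by rw [← d_toM2]; exact hB
        rw [d_toM2, map_mul, Units.val_mul, h2]; decide
      have h6 := cen3_det4 _ hS a b (by rw [← hab]; exact hd4)
      rw [← hab] at h6
      refine ⟨((g₂ * g₂) * (g₂ * g₂)) * (g₂ * g₂),
        G.mul_mem (G.mul_mem (G.mul_mem hg₂ hg₂) (G.mul_mem hg₂ hg₂)) (G.mul_mem hg₂ hg₂), ?_⟩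
      apply toM2_injective
      have e : (((g₂ * g₂) * (g₂ * g₂)) * (g₂ * g₂)) * (((g₂ * g₂) * (g₂ * g₂)) * (g₂ * g₂)) =
          (((g₂ * g₂) * (g₂ * g₂)) * ((g₂ * g₂) * (g₂ * g₂))) * ((g₂ * g₂) * (g₂ * g₂)) := by group
      rw [e, toM2_mul, toM2_mul, toM2_mul, toM2_neg_one]
      exact h6
  · -- non-commuting pair of order 3: an explicit word squares to `−1`
    rcases s3_pair _ hS _ hS' hc with h | h | h
    · exact ⟨s * s', G.mul_mem hs hs'G, sq_eq_neg_one_of_toM2 (by rw [toM2_mul]; exact h)⟩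
    · exact ⟨s * s * s', G.mul_mem (G.mul_mem hs hs) hs'G,
        sq_eq_neg_one_of_toM2 (by rw [toM2_mul, toM2_mul]; exact h)⟩
    · exact ⟨s * s * s' * s * s', G.mul_mem (G.mul_mem (G.mul_mem (G.mul_mem hs hs) hs'G) hs) hs'G,
        sq_eq_neg_one_of_toM2 (by rw [toM2_mul, toM2_mul, toM2_mul, toM2_mul]; exact h)⟩

/-- **order-5 branch**: `u ∈ G` of order 5 and no common `G`-eigenline ⇒ some `g ∈ G` has `g² = −1`. -/
theorem branch5 {u : GL (Fin 2) (ZMod 5)} (hu : u ∈ G) (hU : toM2 u ∈ u5List)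
    (hirr : ∀ w : Fin 2 → ZMod 5, w ≠ 0 → ∃ h ∈ G, ∀ c : ZMod 5,
      (h : Matrix (Fin 2) (Fin 2) (ZMod 5)) *ᵥ w ≠ c • w) :
    ∃ g ∈ G, g * g = -1 := by
  obtain ⟨hdU, hU5, hU1⟩ := u5List_sound _ hU
  obtain ⟨hw0, hw⟩ := fixv_spec _ hU
  set w := fixv (toM2 u) with hw_def
  have hdet_u : Matrix.GeneralLinearGroup.det u = 1 := Units.ext (by rw [← d_toM2]; simpa using hdU)
  have hu5 : (u * u) * (u * u) * u = 1 :=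
    toM2_injective (by rw [toM2_mul, toM2_mul, toM2_mul, toM2_one]; exact hU5)
  obtain ⟨h, hhG, hh⟩ := hirr w hw0
  set u' := h * u * h⁻¹ with hu'_def
  have hu'G : u' ∈ G := G.mul_mem (G.mul_mem hhG hu) (G.inv_mem hhG)
  have hU' : toM2 u' ∈ u5List := by
    refine mem_u5List _ ⟨?_, ?_, ?_⟩
    · rw [d_toM2, hu'_def, map_mul, map_mul, map_inv, hdet_u, mul_one, mul_inv_cancel, Units.val_one]
    · have h5 : (u' * u') * (u' * u') * u' = 1 := by
        have e : (u' * u') * (u' * u') * u' = h * ((u * u) * (u * u) * u) * h⁻¹ := by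
          rw [hu'_def]; group
        rw [e, hu5, mul_one, mul_inv_cancel]
      have := congrArg toM2 h5
      rw [toM2_mul, toM2_mul, toM2_mul, toM2_one] at this
      exact this
    · intro h1
      apply hU1
      have h1' : u' = 1 := toM2_injective (by rw [h1, toM2_one])
      rw [hu'_def, mul_inv_eq_one, mul_eq_left] at h1'
      rw [h1', toM2_one]
  by_cases hc : mul2 (toM2 u) (toM2 u') = mul2 (toM2 u') (toM2 u)
  · -- `h` normalises `⟨u⟩`: it fixes the fixed line of `u` — contradiction with the choice of `h`
    exfalso
    -- `h u h⁻¹ = uᵏ`, i.e. `h u = uᵏ h`, so `uᵏ (h w) = h (u w) = h w`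
    set v := app (toM2 h) w with hv_def
    have key : ∀ uk : GL (Fin 2) (ZMod 5), toM2 u' = toM2 uk → app (toM2 uk) v = v := by
      intro uk huk
      have e : h * u = uk * h := by
        have : u' = uk := toM2_injective huk
        rwa [hu'_def, mul_inv_eq_iff_eq_mul] at this
      have e' := congrArg (fun g => app (toM2 g) w) e
      simp only [toM2_mul, app_mul2] at e'
      rw [hw] at e'
      exact e'.symm
    have hfix : app (toM2 u) v = v ∨ app (sq2 (toM2 u)) v = v ∨ app (p3 (toM2 u)) v = v ∨
        app (p4 (toM2 u)) v = v := by
      have e2 : toM2 (u * u) = sq2 (toM2 u) := by rw [toM2_mul]; rfl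
      have e3 : toM2 (u * u * u) = p3 (toM2 u) := by rw [toM2_mul, toM2_mul]; rfl
      have e4 : toM2 ((u * u) * (u * u)) = p4 (toM2 u) := by rw [toM2_mul, toM2_mul]; rfl
      rcases u5_comm _ hU _ hU' hc with e | e | e | e
      · exact Or.inl (key u e)
      · exact Or.inr (Or.inl (e2 ▸ key (u * u) (e.trans e2.symm)))
      · exact Or.inr (Or.inr (Or.inl (e3 ▸ key (u * u * u) (e.trans e3.symm))))
      · exact Or.inr (Or.inr (Or.inr (e4 ▸ key ((u * u) * (u * u)) (e.trans e4.symm))))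
    obtain ⟨c, hcv⟩ := collinear w v hw0 (fix_pow _ hU v hfix)
    apply hh c
    rw [mulVec_eq_app, ← hv_def, hcv, app_eq_smul]
  · rcases u5_pair _ hU _ hU' hc with e | e | e | e
    · exact ⟨u * u', G.mul_mem hu hu'G, sq_eq_neg_one_of_toM2 (by rw [toM2_mul]; exact e)⟩
    · exact ⟨u * u * u', G.mul_mem (G.mul_mem hu hu) hu'G,
        sq_eq_neg_one_of_toM2 (by rw [toM2_mul, toM2_mul]; exact e)⟩
    · exact ⟨u * u * u * u', G.mul_mem (G.mul_mem (G.mul_mem hu hu) hu) hu'G,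
        sq_eq_neg_one_of_toM2 (by rw [toM2_mul, toM2_mul, toM2_mul]; exact e)⟩
    · exact ⟨(u * u) * (u * u) * u', G.mul_mem (G.mul_mem (G.mul_mem hu hu) (G.mul_mem hu hu)) hu'G,
        sq_eq_neg_one_of_toM2 (by rw [toM2_mul, toM2_mul, toM2_mul]; exact e)⟩

/-- the unit `2 ∈ 𝔽₅ˣ`. -/
def u2 : (ZMod 5)ˣ := ⟨2, 3, by decide, by decide⟩

/-- **A1, THE CORE (THEOREM; gen-12 strengthening of k2's `NegOneIsSquare` — no `H`, no `det(H)² = 1`,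
no non-abelian hypothesis):** `det G = 𝔽₅ˣ` and no common `𝔽₅`-eigenline ⇒ `∃ g ∈ G, g² = −1`. -/
theorem exists_sq_eq_neg_one
    (hdet : ∀ d : (ZMod 5)ˣ, ∃ g ∈ G, Matrix.GeneralLinearGroup.det g = d)
    (hirr : ∀ w : Fin 2 → ZMod 5, w ≠ 0 → ∃ h ∈ G, ∀ c : ZMod 5,
      (h : Matrix (Fin 2) (Fin 2) (ZMod 5)) *ᵥ w ≠ c • w) :
    ∃ g ∈ G, g * g = -1 := by
  obtain ⟨g₂, hg₂G, hg₂⟩ := hdet u2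
  have hg₂v : (Matrix.GeneralLinearGroup.det g₂ : ZMod 5) = 2 := by rw [hg₂]; rfl
  have hB : d (toM2 g₂) = 2 := by rw [d_toM2, hg₂v]
  by_cases hsmall : ∀ g ∈ G, Matrix.GeneralLinearGroup.det g = 1 → (g = 1 ∨ g = -1)
  · -- `G ∩ SL₂ ⊆ {±1}`: `G = {±g₂ᵏ}`; `g₂` has no rational eigenline, so `(g₂⁶)² = −1`
    rcases eig_or_p6 _ hB with ⟨w, hw0, c, hc⟩ | h6
    · exfalso
      have hcw : (g₂ : Matrix (Fin 2) (Fin 2) (ZMod 5)) *ᵥ w = c • w := by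
        rw [mulVec_eq_app, hc, app_eq_smul]
      obtain ⟨h, hhG, hh⟩ := hirr w hw0
      obtain ⟨k, hk⟩ : ∃ k : ℕ, (Matrix.GeneralLinearGroup.det h : ZMod 5) = 2 ^ k := by
        rcases zmod5_cases _ (Matrix.GeneralLinearGroup.det h).ne_zero with e | e | e | e
        · exact ⟨0, e⟩
        · exact ⟨1, e⟩
        · exact ⟨2, e⟩
        · exact ⟨3, e⟩
      have hdk : Matrix.GeneralLinearGroup.det h = Matrix.GeneralLinearGroup.det (g₂ ^ k) :=
        Units.ext (by rw [map_pow, Units.val_pow_eq_pow_val, hg₂v]; exact hk)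
      set t := h * (g₂ ^ k)⁻¹ with ht_def
      have htG : t ∈ G := G.mul_mem hhG (G.inv_mem (G.pow_mem hg₂G k))
      have hdt : Matrix.GeneralLinearGroup.det t = 1 := by
        rw [ht_def, map_mul, map_inv, hdk, mul_inv_cancel]
      have hht : h = t * g₂ ^ k := by rw [ht_def, inv_mul_cancel_right]
      have hpow := mulVec_line_pow hcw k
      rcases hsmall t htG hdt with e | e
      · apply hh (c ^ k)
        rw [hht, e, one_mul, hpow]
      · apply hh (-(c ^ k))
        rw [hht, e, Units.val_mul, Units.val_neg, Units.val_one, ← Matrix.mulVec_mulVec, hpow,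
          Matrix.neg_mulVec, Matrix.one_mulVec, neg_smul]
    · exact ⟨_, G.mul_mem (G.mul_mem (G.mul_mem hg₂G hg₂G) (G.mul_mem hg₂G hg₂G)) (G.mul_mem hg₂G hg₂G),
        pow12_of_toM2 h6⟩
  · push Not at hsmall
    obtain ⟨g₀, hg₀G, hdet₀, hne1, hne2⟩ := hsmall
    have hA : d (toM2 g₀) = 1 := by rw [d_toM2, hdet₀, Units.val_one]
    have hA1 : toM2 g₀ ≠ one2 := fun e => hne1 (toM2_injective (e.trans toM2_one.symm))
    have hA2 : toM2 g₀ ≠ neg2 := fun e => hne2 (toM2_injective (e.trans toM2_neg_one.symm))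
    rcases order_cases _ hA hA1 hA2 with h | h | h
    · exact ⟨g₀, hg₀G, sq_eq_neg_one_of_toM2 h⟩
    · exact branch3 G (G.mul_mem hg₀G hg₀G) hg₂G (by rw [toM2_mul]; exact h) hB
    · exact branch5 G (G.mul_mem hg₀G hg₀G) (by rw [toM2_mul]; exact h) hirr

end Core

/-- **k2's A1 `NegOneIsSquare` (statement VERBATIM = gen-5/7/9, `Iff.rfl` across namespaces).** -/
def NegOneIsSquare : Prop :=
  ∀ (G H : Subgroup (GL (Fin 2) (ZMod 5))), H ≤ G →
    (∀ d : (ZMod 5)ˣ, ∃ g ∈ G, Matrix.GeneralLinearGroup.det g = d) →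
    (∀ h ∈ H, Matrix.GeneralLinearGroup.det h ^ 2 = 1) →
    (∀ w : Fin 2 → ZMod 5, w ≠ 0 → ∃ h ∈ H, ∀ c : ZMod 5,
      (h : Matrix (Fin 2) (Fin 2) (ZMod 5)) *ᵥ w ≠ c • w) →
    (∃ h₁ ∈ H, ∃ h₂ ∈ H, h₁ * h₂ ≠ h₂ * h₁) →
    ∃ g ∈ G, g * g = -1

/-- **A1 (THEOREM, gen 12):** a one-line corollary of the `H`-free core. -/
theorem negOneIsSquare : NegOneIsSquare :=
  fun G H hHG hdet _ hirr _ =>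
    exists_sq_eq_neg_one G hdet fun w hw =>
      let ⟨h, hh, hc⟩ := hirr w hw
      ⟨h, hHG hh, hc⟩

/-! ## §6 A2 — the framing (THEOREM) and Piece A `SquareSource` of the k2 road (PROVED) -/

noncomputable section

open scoped NumberField
open Literature.NumberTheory.EllipticCurves Literature.NumberTheory.Automorphic
open Literature.NumberTheory.GaloisRepresentations Literature.NumberTheory.Automorphic.BCDT
open WeierstrassCurve Field

/-- `det(−1) = 1` in `GL₂(𝔽₅)`. -/
theorem det_neg_one_GL2 : Matrix.GeneralLinearGroup.det (-1 : GL (Fin 2) (ZMod 5)) = 1 :=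
  Units.ext (by rw [← d_toM2, toM2_neg_one]; decide)

/-- **irreducibility over `𝔽₅` read as "no `G`-stable line"** (`G = ρ̄(Γ)`): for every `w ≠ 0` some
`ρ̄ σ` moves the line `𝔽₅·w` (a `Subrepresentation` on `span {w}` would be `⊥` or `⊤`; `⊤` is excluded by
`finrank = 1 ≠ 2`). -/
theorem exists_not_eigen_of_isIrreducible (ρ : ModPGaloisRep ℚ (ZMod 5) 2)
    (hI : FramedRep.IsIrreducible ρ) (w : Fin 2 → ZMod 5) (hw : w ≠ 0) :
    ∃ σ : absoluteGaloisGroup ℚ, ∀ c : ZMod 5,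
      ((ρ σ : GL (Fin 2) (ZMod 5)) : Matrix (Fin 2) (Fin 2) (ZMod 5)) *ᵥ w ≠ c • w := by
  by_contra hcon
  push Not at hcon
  haveI : Representation.IsIrreducible (FramedRep.toRepresentation ρ) := hI
  let K : Subrepresentation (FramedRep.toRepresentation ρ) :=
    { toSubmodule := Submodule.span (ZMod 5) {w}
      apply_mem_toSubmodule := fun σ v hv => by
        rw [FramedRep.toRepresentation_apply_apply]
        obtain ⟨a, rfl⟩ := Submodule.mem_span_singleton.mp hv
        obtain ⟨c, hc⟩ := hcon σ
        rw [Matrix.mulVec_smul, hc, smul_smul]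
        exact Submodule.mem_span_singleton.mpr ⟨a * c, rfl⟩ }
  rcases eq_bot_or_eq_top K with hK | hK
  · have h1 : Submodule.span (ZMod 5) {w} = ⊥ := congrArg Subrepresentation.toSubmodule hK
    exact hw (Submodule.span_singleton_eq_bot.mp h1)
  · have h1 : Submodule.span (ZMod 5) {w} = ⊤ := congrArg Subrepresentation.toSubmodule hK
    have h2 : Module.finrank (ZMod 5) (Submodule.span (ZMod 5) {w}) = 1 := finrank_span_singleton hw
    rw [h1, finrank_top, Module.finrank_fin_fun] at h2
    exact absurd h2 (by norm_num)

/-- **A2 (THEOREM, gen 12; k2-g9 signature VERBATIM — the hypothesis `hG` is no longer needed, the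
`H`-free core `exists_sq_eq_neg_one` is applied to `G = ρ̄(Γ_ℚ)` directly).** -/
theorem helper_exists_tau_sq_eq_neg (hG : NegOneIsSquare) (W : WeierstrassCurve ℚ) [W.IsElliptic]
    (ρ : ModPGaloisRep ℚ (ZMod 5) 2) (hρ : W.IsTorsionGaloisRep 5 ρ)
    (hirr : ρ.IsAbsIrreducibleOverSqrt 5) :
    ∃ τ : absoluteGaloisGroup ℚ, (∀ P : W.geomTorsion 5, τ • (τ • P) = -P) ∧
      modNCyclotomicCharacter ℚ 5 (τ * τ) = 1 := by
  haveI : NeZero ((5 : ℕ) : ℚ) := ⟨by norm_num⟩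
  -- `det ρ̄ = χ̄₅` (tree THEOREM, Weil pairing) and `χ̄₅ : Γ_ℚ → 𝔽₅ˣ` onto (tree THEOREM)
  have hdetχ : ∀ σ : absoluteGaloisGroup ℚ,
      Matrix.GeneralLinearGroup.det (ρ σ) = modNCyclotomicCharacter ℚ 5 σ := fun σ => by
    rw [← modPCyclotomicCharacterZMod_eq_modNCyclotomicCharacter]
    exact W.det_eq_modPCyclotomicCharacter_of_isTorsionGaloisRep_holds 5 ρ hρ σ
  set G : Subgroup (GL (Fin 2) (ZMod 5)) := MonoidHom.range ρ.toMonoidHom with hG_def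
  have hmem : ∀ σ : absoluteGaloisGroup ℚ, ρ σ ∈ G := fun σ => MonoidHom.mem_range.mpr ⟨σ, rfl⟩
  have hdet : ∀ d : (ZMod 5)ˣ, ∃ g ∈ G, Matrix.GeneralLinearGroup.det g = d := fun d => by
    obtain ⟨σ, hσ⟩ := Rat.modNCyclotomicCharacter_surjective 5 d
    exact ⟨ρ σ, hmem σ, by rw [hdetχ, hσ]⟩
  -- absolutely irreducible over `ℚ(√5)` ⇒ irreducible over `𝔽₅` ⇒ no common eigenline
  have hirr5 : ∀ w : Fin 2 → ZMod 5, w ≠ 0 → ∃ h ∈ G, ∀ c : ZMod 5,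
      (h : Matrix (Fin 2) (Fin 2) (ZMod 5)) *ᵥ w ≠ c • w := fun w hw => by
    obtain ⟨σ, hσ⟩ := exists_not_eigen_of_isIrreducible ρ
      hirr.isAbsolutelyIrreducible.isIrreducible w hw
    exact ⟨ρ σ, hmem σ, hσ⟩
  -- A1
  obtain ⟨g, hgG, hg⟩ := exists_sq_eq_neg_one G hdet hirr5
  obtain ⟨τ, hτ⟩ := MonoidHom.mem_range.mp hgG
  have hg' : ρ τ * ρ τ = -1 := by rw [← hg, ← hτ]; rfl
  refine ⟨τ, fun P => ?_, ?_⟩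
  · -- through the frame: `e (τ • (τ • P)) = ρ̄(τ)² · e P = −e P`
    obtain ⟨e, he⟩ := hρ
    apply e.injective
    rw [he, he, Matrix.mulVec_mulVec, ← Units.val_mul, hg', map_neg, Units.val_neg, Units.val_one,
      Matrix.neg_mulVec, Matrix.one_mulVec]
  · -- `χ̄₅(τ²) = det(ρ̄ τ)² = det(−1) = 1`
    rw [map_mul, ← hdetχ, ← map_mul, hg', det_neg_one_GL2]

/-- **Piece A of the k2 road (k2-g9 `SquareSource`, statement VERBATIM).** -/
def SquareSource : Prop :=
  ∀ (W : WeierstrassCurve ℚ) [W.IsElliptic] (ρ : ModPGaloisRep ℚ (ZMod 5) 2),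
    W.IsTorsionGaloisRep 5 ρ → ρ.IsAbsIrreducibleOverSqrt 5 →
    ∃ τ : absoluteGaloisGroup ℚ, (∀ P : W.geomTorsion 5, τ • (τ • P) = -P) ∧
      modNCyclotomicCharacter ℚ 5 (τ * τ) = 1

/-- k2-g9's glue, verbatim. -/
theorem squareSource_of (hG : NegOneIsSquare) : SquareSource :=
  fun W _ ρ hρ hirr => helper_exists_tau_sq_eq_neg hG W ρ hρ hirr

/-- **PIECE A IS PROVED (gen 12).** -/
theorem squareSource : SquareSource := squareSource_of negOneIsSquare

end

/-! ## §7 B6α — a `φ`-fixed root of Fisher's `𝔇_B(·,1)` (THEOREM modulo the gen-6 KERNEL CERTIFICATE)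

`helper_fixed_cusp_root_of_cert (hcert : CuspCertificate) …` has, after `hcert`, the k2-g9 binders and conclusion of
`helper_fixed_cusp_root` VERBATIM.  `CuspCertificate` is PROVED — verbatim modulo namespace — as
`StubSwitchK2G6.D_LL_MM_eq_zero` (`…_2g6_Cert.lean`, 174 KB, not importable here: crux workfiles are not built as
modules on the farm).  The composition WAS kernel-checked this session in a scratch file `…_2g6_Cert.lean ⊕ §7`
(`lean check` rc 0, 0 sorries, 136 s; `#print axioms` = `propext, Classical.choice, Quot.sound`):
`theorem helper_fixed_cusp_root <k2-g9 signature> := helper_fixed_cusp_root_of_cert (fun c₄ c₆ x p hψ hp =>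
StubSwitchK2G6.D_LL_MM_eq_zero c₄ c₆ x p hψ hp) c₄ c₆ hΔ hζ hneg` — the two copies of `PSI5/LL/MM` are defeq. -/

noncomputable section

open scoped NumberField
open Literature.NumberTheory.EllipticCurves Literature.NumberTheory.EllipticCurves.HesseFamilyFive
open Literature.NumberTheory.GaloisRepresentations Literature.NumberTheory.Automorphic
open WeierstrassCurve Field

/-- k2 vocabulary (verbatim): Fisher's integral model `y² = x³ − 27c₄x − 54c₆`. -/
abbrev base (c₄ c₆ : ℚ) : WeierstrassCurve ℚ := ⟨0, 0, 0, -27 * c₄, -54 * c₆⟩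

section CertVocabulary
variable {R : Type*} [CommRing R]

/-- the `5`-division polynomial `ψ₅(x)` of `y² = x³ − 27c₄x − 54c₆` (gen-6 cert, verbatim). -/
def PSI5 (c₄ c₆ x : R) : R :=
  (5 : R) * x ^ 12 + (-1674 : R) * x ^ 10 * c₄ + (-20520 : R) * x ^ 9 * c₆ + (-76545 : R) * x ^ 8 * c₄ ^ 2 + (349920 : R) * x ^ 7 * c₄ * c₆ + (5904900 : R) * x ^ 6 * c₄ ^ 3 + (-699840 : R) * x ^ 6 * c₆ ^ 2 + (27398736 : R) * x ^ 5 * c₄ ^ 2 * c₆ + (-66430125 : R) * x ^ 4 * c₄ ^ 4 + (151165440 : R) * x ^ 4 * c₄ * c₆ ^ 2 + (-85030560 : R) * x ^ 3 * c₄ ^ 3 * c₆ + (251942400 : R) * x ^ 3 * c₆ ^ 3 + (717445350 : R) * x ^ 2 * c₄ ^ 5 + (-510183360 : R) * x ^ 2 * c₄ ^ 2 * c₆ ^ 2 + (2869781400 : R) * x * c₄ ^ 4 * c₆ + (-2720977920 : R) * x * c₄ * c₆ ^ 3 + (387420489 : R) * c₄ ^ 6 + (1836660096 : R) * c₄ ^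 3 * c₆ ^ 2 + (-2176782336 : R) * c₆ ^ 4

/-- `LL0 = 4x·f(x)` (gen-6 cert, verbatim). -/
def LL0 (c₄ c₆ x : R) : R :=
  (4 : R) * x ^ 4 + (-108 : R) * x ^ 2 * c₄ + (-216 : R) * x * c₆

/-- `LL1 = 4x·f(x) − N(x)` (gen-6 cert, verbatim). -/
def LL1 (c₄ c₆ x : R) : R :=
  (3 : R) * x ^ 4 + (-162 : R) * x ^ 2 * c₄ + (-648 : R) * x * c₆ + (-729 : R) * c₄ ^ 2

/-- `LL = LL0 + p·LL1` (gen-6 cert, verbatim). -/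
def LL (c₄ c₆ x p : R) : R :=
  LL0 c₄ c₆ x + p * LL1 c₄ c₆ x

/-- `MM = 12·f(x)` (gen-6 cert, verbatim). -/
def MM (c₄ c₆ x : R) : R :=
  (12 : R) * x ^ 3 + (-324 : R) * x * c₄ + (-648 : R) * c₆

/-- BRIDGE (gen-6 cert, verbatim): Mathlib's `preΨ'₅` of `⟨0,0,0,−27c₄,−54c₆⟩` evaluates to `PSI5`. -/
theorem eval_preΨ'_five (c₄ c₆ x : R) :
    ((⟨0, 0, 0, -27 * c₄, -54 * c₆⟩ : WeierstrassCurve R).preΨ' 5).eval x = PSI5 c₄ c₆ x := by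
  have key := (⟨0, 0, 0, -27 * c₄, -54 * c₆⟩ : WeierstrassCurve R).preΨ'_odd 0
  simp only [zero_add, Even.zero, ↓reduceIte, mul_one, WeierstrassCurve.preΨ'_four,
    WeierstrassCurve.preΨ'_two, WeierstrassCurve.preΨ'_one, WeierstrassCurve.preΨ'_three, one_pow,
    one_mul] at key
  rw [key]
  simp only [WeierstrassCurve.preΨ₄, WeierstrassCurve.Ψ₃, WeierstrassCurve.Ψ₂Sq, WeierstrassCurve.b₂,
    WeierstrassCurve.b₄, WeierstrassCurve.b₆, WeierstrassCurve.b₈, Polynomial.eval_add,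
    Polynomial.eval_sub, Polynomial.eval_mul, Polynomial.eval_pow, Polynomial.eval_C, Polynomial.eval_X,
    Polynomial.eval_ofNat, PSI5]
  ring

/-- `MM = 12y²` on the curve (gen-6 cert, verbatim). -/
theorem MM_eq_twelve_mul_sq {K : Type*} [Field K] (c₄ c₆ x y : K)
    (h : (⟨0, 0, 0, -27 * c₄, -54 * c₆⟩ : WeierstrassCurve K).toAffine.Equation x y) :
    MM c₄ c₆ x = 12 * y ^ 2 := by
  rw [WeierstrassCurve.Affine.equation_iff] at h
  simp only [MM]
  linear_combination (-12 : K) * h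

/-- `𝔇` is homogeneous of degree `12` in `(λ, μ)` (k2-g4 `helper_D_smul`, PROVED by `ring`). -/
theorem D_smul (c₄ c₆ t l m : R) : D c₄ c₆ (t * l) (t * m) = t ^ 12 * D c₄ c₆ l m := by
  simp only [D]; ring

end CertVocabulary

/-- **The gen-6 KERNEL CERTIFICATE's conclusion, as a named statement** (PROVED — verbatim modulo
namespace — as `StubSwitchK2G6.D_LL_MM_eq_zero` in `…_2g6_Cert.lean`, 174 KB, `lean check` rc 0 there;
NOT re-elaborated in this file): `ψ₅(x) = 0 ∧ p² + p − 1 = 0 ⇒ 𝔇(c₄,c₆; LL(x,p), MM(x)) = 0` over `\bar ℚ`. -/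
def CuspCertificate : Prop :=
  ∀ (c₄ c₆ x p : AlgebraicClosure ℚ),
    PSI5 c₄ c₆ x = 0 → p ^ 2 + p - 1 = 0 → D c₄ c₆ (LL c₄ c₆ x p) (MM c₄ c₆ x) = 0

/-- the base change of Fisher's model to `\bar ℚ` is the literal short model with cast coefficients. -/
theorem base_baseChange (c₄ c₆ : ℤ) :
    (base (c₄ : ℚ) (c₆ : ℚ)).baseChange (AlgebraicClosure ℚ) =
      ⟨0, 0, 0, -27 * (c₄ : AlgebraicClosure ℚ), -54 * (c₆ : AlgebraicClosure ℚ)⟩ := by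
  ext <;> simp [WeierstrassCurve.baseChange, WeierstrassCurve.map]

section B6alpha
open scoped Classical

/-- **B6α modulo the certificate (THEOREM, gen 12; conclusion and binders = k2-g9
`helper_fixed_cusp_root` VERBATIM, plus the named hypothesis `hcert : CuspCertificate`).** -/
theorem helper_fixed_cusp_root_of_cert (hcert : CuspCertificate) (c₄ c₆ : ℤ) (hΔ : c₄ ^ 3 ≠ c₆ ^ 2)
    [(base (c₄ : ℚ) (c₆ : ℚ)).IsElliptic]
    {φ : absoluteGaloisGroup ℚ} (hζ : modNCyclotomicCharacter ℚ 5 φ = 1)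
    (hneg : ∀ P : (base (c₄ : ℚ) (c₆ : ℚ)).geomTorsion 5, φ • P = -P) :
    ∃ ξ : AlgebraicClosure ℚ, φ • ξ = ξ ∧
      D (c₄ : AlgebraicClosure ℚ) (c₆ : AlgebraicClosure ℚ) ξ 1 = 0 := by
  haveI : NeZero ((5 : ℕ) : ℚ) := ⟨by norm_num⟩
  -- (1) a non-zero `5`-torsion point `T`
  obtain ⟨T, hT0⟩ : ∃ T : (base (c₄ : ℚ) (c₆ : ℚ)).geomTorsion 5, T ≠ 0 := by
    obtain ⟨ρ, e, -⟩ := (base (c₄ : ℚ) (c₆ : ℚ)).exists_isTorsionGaloisRep 5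
    refine ⟨e.symm (Pi.single 0 1), fun h0 => ?_⟩
    have h1 := congrArg e h0
    rw [AddEquiv.apply_symm_apply, map_zero] at h1
    have h2 := congrFun h1 0
    simp at h2
  obtain ⟨P, hPmem⟩ := T
  change ((base (c₄ : ℚ) (c₆ : ℚ)).baseChange (AlgebraicClosure ℚ)).toAffine.Point at P
  rcases P with _ | ⟨x, y, hxy⟩
  · exact (hT0 rfl).elim
  -- (2) `φ T = −T` coordinatewise: `φ x = x`
  have hφ := congrArg Subtype.val (hneg ⟨Affine.Point.some x y hxy, hPmem⟩)
  change Affine.Point.map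
      ((show AlgebraicClosure ℚ ≃ₐ[ℚ] AlgebraicClosure ℚ from φ) :
        AlgebraicClosure ℚ →ₐ[ℚ] AlgebraicClosure ℚ) (Affine.Point.some x y hxy) =
      -Affine.Point.some x y hxy at hφ
  rw [Affine.Point.map_some, Affine.Point.neg_some] at hφ
  simp only [Affine.Point.some.injEq, AlgEquiv.coe_toAlgHom] at hφ
  have hx : absoluteGaloisGroup.toAlgEquiv ℚ φ x = x := hφ.1
  -- (3) `5 • T = 0` ⇒ `ψ₅(x) = 0`
  have hT5 : (5 : ℤ) • (Affine.Point.some x y hxy :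
      ((base (c₄ : ℚ) (c₆ : ℚ)).baseChange (AlgebraicClosure ℚ)).toAffine.Point) = 0 :=
    (Submodule.mem_torsionBy_iff _ _).mp hPmem
  have hψ := (((base (c₄ : ℚ) (c₆ : ℚ)).baseChange (AlgebraicClosure ℚ)).zsmul_some_eq_zero_iff_eval_ΨSq
    hxy 5).mp hT5
  rw [base_baseChange, show (5 : ℤ) = ((5 : ℕ) : ℤ) from rfl, WeierstrassCurve.ΨSq_ofNat] at hψ
  have h5odd : ¬ Even (5 : ℕ) := by decide
  simp only [h5odd, ↓reduceIte, mul_one, Polynomial.eval_pow, eval_preΨ'_five] at hψ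
  have hψ5 : PSI5 (c₄ : AlgebraicClosure ℚ) (c₆ : AlgebraicClosure ℚ) x = 0 :=
    (pow_eq_zero_iff two_ne_zero).mp hψ
  -- (4) the equation and `y ≠ 0` (`T` has odd order)
  have heq : (⟨0, 0, 0, -27 * (c₄ : AlgebraicClosure ℚ), -54 * (c₆ : AlgebraicClosure ℚ)⟩ :
      WeierstrassCurve (AlgebraicClosure ℚ)).toAffine.Equation x y := base_baseChange c₄ c₆ ▸ hxy.1
  have hM := MM_eq_twelve_mul_sq _ _ x y heq
  have hy0 : y ≠ 0 := by
    intro hy0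
    have hnegP : -(Affine.Point.some x y hxy :
        ((base (c₄ : ℚ) (c₆ : ℚ)).baseChange (AlgebraicClosure ℚ)).toAffine.Point) =
        Affine.Point.some x y hxy := by
      rw [Affine.Point.neg_some]
      simp only [Affine.Point.some.injEq, true_and]
      simp [WeierstrassCurve.Affine.negY, WeierstrassCurve.baseChange, WeierstrassCurve.map, hy0]
    have hPP : (Affine.Point.some x y hxy :
        ((base (c₄ : ℚ) (c₆ : ℚ)).baseChange (AlgebraicClosure ℚ)).toAffine.Point) +
        Affine.Point.some x y hxy = 0 := by
      nth_rewrite 2 [← hnegP]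
      exact add_neg_cancel _
    have hP0 : (Affine.Point.some x y hxy :
        ((base (c₄ : ℚ) (c₆ : ℚ)).baseChange (AlgebraicClosure ℚ)).toAffine.Point) = 0 := by
      have e : (Affine.Point.some x y hxy :
          ((base (c₄ : ℚ) (c₆ : ℚ)).baseChange (AlgebraicClosure ℚ)).toAffine.Point) =
          (5 : ℤ) • Affine.Point.some x y hxy - (2 : ℤ) • (Affine.Point.some x y hxy +
            Affine.Point.some x y hxy) := by
        abel
      rw [hT5, hPP, zsmul_zero, sub_zero] at e
      exact e
    exact hT0 (Subtype.ext hP0)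
  have hM0 : MM (c₄ : AlgebraicClosure ℚ) (c₆ : AlgebraicClosure ℚ) x ≠ 0 := by
    rw [hM]; exact mul_ne_zero (by norm_num) (pow_ne_zero 2 hy0)
  -- (5) a primitive 5th root of unity `ζ`, fixed by `φ` since `χ̄₅(φ) = 1`; `p := ζ + ζ⁴`
  obtain ⟨ζ, hζp⟩ := HasEnoughRootsOfUnity.exists_primitiveRoot (AlgebraicClosure ℚ) 5
  have hζ5 : ζ ^ 5 = 1 := hζp.pow_eq_one
  have hφζ : φ • ζ = ζ := by
    rw [modNCyclotomicCharacter_spec ℚ 5 φ ζ hζ5, hζ, Units.val_one, ZMod.val_one, pow_one]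
  have hgeom : 1 + ζ + ζ ^ 2 + ζ ^ 3 + ζ ^ 4 = 0 := by
    have h := hζp.geom_sum_eq_zero (by norm_num : 1 < 5)
    simp only [Finset.sum_range_succ, Finset.sum_range_zero, pow_zero, pow_one, zero_add] at h
    linear_combination h
  set p : AlgebraicClosure ℚ := ζ + ζ ^ 4 with hpdef
  have hpp : p ^ 2 + p - 1 = 0 := by
    rw [hpdef]; linear_combination hgeom + (2 + ζ ^ 3) * hζ5
  have hφp : absoluteGaloisGroup.toAlgEquiv ℚ φ p = p := by
    have : φ • p = p := by rw [hpdef, smul_add, smul_pow', hφζ]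
    rwa [absoluteGaloisGroup.smul_def] at this
  -- (6) the certificate and homogeneity: `ξ := LL/MM` is a root of `𝔇(·,1)`
  have hD := hcert (c₄ : AlgebraicClosure ℚ) (c₆ : AlgebraicClosure ℚ) x p hψ5 hpp
  set ξ : AlgebraicClosure ℚ := LL (c₄ : AlgebraicClosure ℚ) (c₆ : AlgebraicClosure ℚ) x p /
    MM (c₄ : AlgebraicClosure ℚ) (c₆ : AlgebraicClosure ℚ) x with hξdef
  have hLL : MM (c₄ : AlgebraicClosure ℚ) (c₆ : AlgebraicClosure ℚ) x * ξ =
      LL (c₄ : AlgebraicClosure ℚ) (c₆ : AlgebraicClosure ℚ) x p := by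
    rw [hξdef, ← mul_div_assoc, mul_div_cancel_left₀ _ hM0]
  have hDξ : D (c₄ : AlgebraicClosure ℚ) (c₆ : AlgebraicClosure ℚ) ξ 1 = 0 := by
    have key : MM (c₄ : AlgebraicClosure ℚ) (c₆ : AlgebraicClosure ℚ) x ^ 12 *
        D (c₄ : AlgebraicClosure ℚ) (c₆ : AlgebraicClosure ℚ) ξ 1 = 0 := by
      rw [← D_smul, hLL, mul_one]; exact hD
    exact (mul_eq_zero.mp key).resolve_left (pow_ne_zero 12 hM0)
  -- (7) `φ` fixes `ξ` (it fixes `x`, `p` and `ℚ`)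
  refine ⟨ξ, ?_, hDξ⟩
  rw [absoluteGaloisGroup.smul_def, hξdef]
  simp only [LL, LL0, LL1, MM, map_div₀, map_add, map_mul, map_pow, map_neg, map_intCast, map_ofNat,
    hx, hφp]

end B6alpha

end

end Summit.ABC.ABC.Cruxes.FreyModularity.StubSwitchK1G12
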